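import Mathlib
import HarnessLib
import Summits.HubbardSuperconductivity.HubbardSuperconductivity.Theorems.KLProgrammeKLRegimeSplitBundleV7
import Summits.HubbardSuperconductivity.HubbardSuperconductivity.Theorems.KLProgrammeKLRegimeSplitLegCount

/-!
# Route `KLProgramme` — crux K3 `KLRegimeTwoPointLimit` (stmt-HubbardSuperconductivity-19937): the bundle
# `klPredsV8 := { FrameOK, RenormalisedAtF, BetaSplitAtS2, EngineBoundsAtV6S, TwoLegStepV8 }` — V7 with the (D) leg-dressing COUNT read in the
# cutoff's own variable (defect Δ16, seat hubbard-kl-k3c2-p3; plan g10 ruling 2026-08-26T16:35:51Z: repair (R-a), gen-3 resplit onto `klPredsV8`)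

Δ16 (HOME/STATUS 16:18Z, HOME/hubbard-kl-k3c2-p3/DELTA16-NOTE.md, `…SplitLegCount` p456260).  The three (D)-carrying clauses of the V7 engine slot
((E2-v5) `PairLadderStepAtV5`, (E2″-v5) `PairValueIncrementAtV5`, (E2′-S2) `QuarticValueIncrementAtS2`, `…SplitLegStaging`) bound the
one-particle-reducible dressing of the external legs by `legDressBarQ G P Q U n (legSliceCount L μ K n legs)`, where p1's `legSliceCount` windows
the FRAME ENERGY `|e_K(k_i)| ∈ [Λ_{n+2}, Λ_{n−2}]`.  The slice-`n` covariance at the reading frequency `±ω₀ = ±π/β` carries the weight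
`χ₂(t²/Λ_n²) − χ₂(t²/Λ²_{n−1})` with `t(k⃗)² = ω₀² + e_K(k⃗)²` (`hubbardCutoffWeightCT`), nonzero iff `Λ_n/2 < t < Λ_{n−1}` (`klld_slice_support`):
at the thermal end `n ∈ {n_β, n_β+1}` (`ω₀ > Λ_{n+1}`) legs with `|e_K| < Λ_{n+2}` — e.g. ON the frame's Fermi curve — are dressed but not
counted, and their residual-local-part dressing `≤ 64·cr·|U|·4^{−n}` is `R`-level (`RenormalisedAtF`), which no `G/P`-level term of the clauses
carries for every `R` (order `∃G ∀P ∀R ∃Q`; worked instance β = 251, n = 1: 1PR part `1.25·cr·U²` against an `O_{G,P}(U²)` right-hand side).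
REPAIR (R-a): count in the variable the cutoff reads — `legSliceCountT L β μ K n legs = #{i : Λ_{n+2} ≤ √((π/β)² + e_K(k_i)²) ≤ Λ_{n−2}}`
(`…SplitLegCount`: every dressed leg is counted at every `n ≥ 1`, `klld_counted_of_weight_ne`; `Σ_{n ≤ N} ≤ 20` unchanged,
`legSliceCountT_sum_le`).  CONTENT FREEZE (plan g10 l.797/l.894): count swap ONLY — every other text of V7 verbatim; the split slot
`BetaSplitAtS2` does not mention the count (only `klLegKappa`) and is UNCHANGED; (E0) stays a conjunct although now a theorem (p455831).

THE BUNDLE: `PairLadderStepAtV6 / PairValueIncrementAtV6 / QuarticValueIncrementAtS3` := the V5 / V5 / S2 texts with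
`legSliceCount L μ K n ·` ↦ `legSliceCountT L β μ K n ·`; `EngineBoundsAtV6S` := `EngineBoundsAtV5S` with those three swapped;
`histV8 := BetaSplitAtS2 ∧ RenormalisedAtF ∧ EngineBoundsAtV6S`; `TwoLegStepV8 := TwoLegStepG histV8 ∧ TwoLegVolumeRate (histV8 ∧ TwoLegStepG histV8)`;
`klPredsV8 := { frameOK := FrameOK, renorm := RenormalisedAtF, split := BetaSplitAtS2, engine := EngineBoundsAtV6S, twoLeg := TwoLegStepV8 }`;
slot `rfl` lemmas; `histV8_of_histP`, `twoLegStepG_of_twoLegStepV8`, `histRateV8_of_histP`; and the scale-`0` coincidences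
`pairLadderStepAtV6_zero_iff`, `engineBoundsAtV6S_zero_iff` (the count is not read at `n = 0`: the rung `stub_engine_scale0` ports between V5S
and V6S by `Iff`).  Children of gen 3 (plan g10 l.894 / plan2 l.902): `KLRegimeEngineV8 / KLRegimeBetaSplitV8 / KLRegimeCountertermV8 /
KLRegimeVolumeLimitV8 / KLRegimeTwoPointAssemblyV8` on `klPredsV8 klWindowC` (generic bodies `…SplitGenericV3`, or `…GenericV4` if p1's Δ17
`EngineP4`/`VolumeLimitP2` is ruled in); glue closer in `…SplitGlueV8*`.  Definitions (+ `rfl`/`Iff` bookkeeping) only; nothing is asserted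
about the model.
-/

noncomputable section

namespace Summit.HubbardSuperconductivity.HubbardSuperconductivity.Theorems.KLRegimeSplit

set_option linter.dupNamespace false -- summit = problem name (single-conjunct summit), D-0017

open Real Finset Literature.MathematicalPhysics.QuantumLattice Literature.Probability.LatticeModels
open Summit.HubbardSuperconductivity.HubbardSuperconductivity.Theorems.KLProgrammeLegKernels

/-! ## §1 The engine clauses, v6: (D) count temperature-aware -/

section Model

variable (L M : ℕ) [NeZero L] [NeZero M]

/-- **(E2-v6) one pair-ladder step per scale** — `PairLadderStepAtV5` with `legSliceCount L μ K n ↦ legSliceCountT L β μ K n`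
(the crossing count read in the reading radius `√((π/β)² + e_K²)`, so that every leg dressed by the slice-`n` covariance at `±ω₀` is counted,
`klld_counted_of_weight_ne`). -/
def PairLadderStepAtV6 (G : GeoConsts) (P : SplitConsts) (Q : EngConsts) (β U μ : ℝ) (K : TrigPolyC4v) (n : ℕ) : Prop :=
  (n = 0 → ∀ Qm : TorusSite 2 L, ∀ k ∈ klBall L μ K, ∀ k' ∈ klBall L μ K,
      ‖klPairAmplitude L M β U μ K 0 Qm k k' - (U : ℂ)‖ ≤ initDevBar G U) ∧
  (1 ≤ n → ∀ Qm : TorusSite 2 L, IsPairClassAt L Qm n →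
      ∃ w : TorusSite 2 L → ℝ, (∀ p, 0 ≤ w p) ∧ (∑ p, w p ≤ G.bhi) ∧
        ∃ N : Matrix (TorusSite 2 L) (TorusSite 2 L) ℂ,
          (1 + Matrix.diagonal (fun p => (w p : ℂ)) * klPairArray L M β U μ K (n - 1) Qm) * N = 1 ∧
          ∀ k ∈ klBall L μ K, ∀ k' ∈ klBall L μ K,
            ‖klPairAmplitude L M β U μ K n Qm k k' - (klPairArray L M β U μ K (n - 1) Qm * N) k k'‖ ≤
              drivePBar G P U (n - 1) + eremBar G P Q U β L (n - 1) + thermalBar G P U β n +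
                legDressBarQ G P Q U n (legSliceCountT L β μ K n ![k', Qm - k', Qm - k, k]))

/-- **(E2″-v6) value increments of the pair arrays** — `PairValueIncrementAtV5` with the temperature-aware count. -/
def PairValueIncrementAtV6 (G : GeoConsts) (P : SplitConsts) (Q : EngConsts) (β U μ : ℝ) (K : TrigPolyC4v) (n : ℕ) : Prop :=
  1 ≤ n → ∀ Qm : TorusSite 2 L, ∀ k ∈ klBall L μ K, ∀ k' ∈ klBall L μ K,
    ‖klPairAmplitude L M β U μ K n Qm k k' - klPairAmplitude L M β U μ K (n - 1) Qm k k'‖ ≤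
      gainBar G P U n (klTorusNorm L Qm) (klTorusNorm L (k - k')) (klTorusNorm L (k + k' - Qm)) +
        eremBar G P Q U β L (n - 1) + thermalBar G P U β n +
          legDressBarQ G P Q U n (legSliceCountT L β μ K n ![k', Qm - k', Qm - k, k])

/-- **(E2′-S3) pointwise increments of the `↑↓` running coupling values at the true transfers** — `QuarticValueIncrementAtS2` with the
temperature-aware count (legs `(k₁, k₂, k₃, k₁ − k₂ + k₃)`). -/
def QuarticValueIncrementAtS3 (G : GeoConsts) (P : SplitConsts) (Q : EngConsts) (β U μ : ℝ) (K : TrigPolyC4v) (n : ℕ) : Prop :=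
  1 ≤ n → ∀ k₁ ∈ klBall L μ K, ∀ k₂ ∈ klBall L μ K, ∀ k₃ ∈ klBall L μ K,
    ‖klQuarticValue L M β U μ K n 0 1 k₁ k₂ k₃ - klQuarticValue L M β U μ K (n - 1) 0 1 k₁ k₂ k₃‖ ≤
      gainBar G P U n (klTorusNorm L (k₁ + k₃)) (klTorusNorm L (k₁ - k₂)) (klTorusNorm L (k₂ - k₃)) +
        eremBar G P Q U β L (n - 1) + thermalBar G P U β n +
          legDressBarQ G P Q U n (legSliceCountT L β μ K n ![k₁, k₂, k₃, k₁ - k₂ + k₃])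

/-- **`EngineBoundsAtV6S … G P Q K n`** = `EngineBoundsAtV5S` with the three (D)-carrying clauses read at the temperature-aware count:
(E0) ∧ (E1-v4) ∧ (E2-v6) ∧ (E2″-v6) ∧ (E2′-S3) ∧ (E2′-S UV) ∧ (E4) ∧ (E5-S).  Same slot type as `Preds.engine`. -/
def EngineBoundsAtV6S (G : GeoConsts) (P : SplitConsts) (Q : EngConsts) (β U μ : ℝ) (K : TrigPolyC4v) (n : ℕ) : Prop :=
  SelfEnergySymmetric L M β U μ K n ∧ KernelNormsV4 L M P Q β U μ K n ∧
    PairLadderStepAtV6 L M G P Q β U μ K n ∧ PairValueIncrementAtV6 L M G P Q β U μ K n ∧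
      QuarticValueIncrementAtS3 L M G P Q β U μ K n ∧ QuarticValueUVAtS L M G β U μ K n ∧
        EngineFirstMoments L M G P Q β U μ K n ∧ IsoTupleL1AtS L M G P β U μ K n

/-! ## §2 The V8 history, two-leg slot and bundle -/

/-- **The comparison-frame / comparison-volume history of the V8 bundle** at scale `j`: `BetaSplitAtS2 ∧ RenormalisedAtF ∧ EngineBoundsAtV6S`
(= this bundle's `split ∧ renorm ∧ engine`, so `HistP klPredsV8` discharges it at any volume: `histV8_of_histP`). -/
def histV8 (G : GeoConsts) (P : SplitConsts) (Q : EngConsts) (R : RenConsts) (β U μ : ℝ) : TrigPolyC4v → ℕ → Prop :=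
  fun K' j => BetaSplitAtS2 L M G P Q β U μ K' j ∧ RenormalisedAtF L M β U μ K' R j ∧ EngineBoundsAtV6S L M G P Q β U μ K' j

/-- **`TwoLegStepV8 … G P Q R K n`** := `TwoLegStepG histV8 ∧ TwoLegVolumeRate (histV8 ∧ TwoLegStepG histV8)` — V7's two-leg slot verbatim, read
at the V8 history (the (E3f) antecedent = the full non-self history at the comparison volume).  Same slot type as `Preds.twoLeg`. -/
def TwoLegStepV8 (G : GeoConsts) (P : SplitConsts) (Q : EngConsts) (R : RenConsts) (β U μ : ℝ) (K : TrigPolyC4v) (n : ℕ) :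
    Prop :=
  TwoLegStepG L M (histV8 L M G P Q R β U μ) G P Q R β U μ K n ∧
    TwoLegVolumeRate L M
      (fun L' M' _ _ K' j => histV8 L' M' G P Q R β U μ K' j ∧ TwoLegStepG L' M' (histV8 L' M' G P Q R β U μ) G P Q R β U μ K' j)
      Q β U μ K n

end Model

/-- **`klPredsV8 : Preds`** := `{ frameOK := FrameOK, renorm := RenormalisedAtF, split := BetaSplitAtS2, engine := EngineBoundsAtV6S,
twoLeg := TwoLegStepV8 }` — V7 (p2 p450883) with the (D) count of the engine slot read in the cutoff's variable (Δ16, repair (R-a)).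
Children of gen 3: `EngineP3|P4 klPredsV8 klWindowC`, `BetaSplitP klPredsV8 klWindowC`, `CountertermP2 klPredsV8 klWindowC`,
`VolumeLimitP|P2 klPredsV8 FinalTwoLegVolLimit klWindowC`, `TwoPointAssemblyP3 klPredsV8 FinalTwoLegVolLimit klWindowC`. -/
def klPredsV8 : Preds where
  frameOK := FrameOK
  renorm := fun L M _ _ β U μ K R n => RenormalisedAtF L M β U μ K R n
  split := fun L M _ _ G P Q β U μ K n => BetaSplitAtS2 L M G P Q β U μ K n
  engine := fun L M _ _ G P Q β U μ K n => EngineBoundsAtV6S L M G P Q β U μ K n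
  twoLeg := fun L M _ _ G P Q R β U μ K n => TwoLegStepV8 L M G P Q R β U μ K n

/-! ## §3 Bookkeeping (`rfl`-level) -/

/-- V8's frame class IS V7's (`FrameOK`). -/
theorem klPredsV8_frameOK : klPredsV8.frameOK = klPredsV7.frameOK := rfl

/-- V8's renormalisation slot IS V7's (`RenormalisedAtF`). -/
theorem klPredsV8_renorm : klPredsV8.renorm = klPredsV7.renorm := rfl

/-- V8's split slot IS V7's (`BetaSplitAtS2` — the count is not read by the split). -/
theorem klPredsV8_split : klPredsV8.split = klPredsV7.split := rfl

/-- V8's split slot is `BetaSplitAtS2`. -/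
theorem klPredsV8_split_apply (L M : ℕ) [NeZero L] [NeZero M] (G : GeoConsts) (P : SplitConsts) (Q : EngConsts) (β U μ : ℝ)
    (K : TrigPolyC4v) (n : ℕ) : klPredsV8.split L M G P Q β U μ K n = BetaSplitAtS2 L M G P Q β U μ K n := rfl

/-- V8's engine slot is `EngineBoundsAtV6S`. -/
theorem klPredsV8_engine (L M : ℕ) [NeZero L] [NeZero M] (G : GeoConsts) (P : SplitConsts) (Q : EngConsts) (β U μ : ℝ)
    (K : TrigPolyC4v) (n : ℕ) : klPredsV8.engine L M G P Q β U μ K n = EngineBoundsAtV6S L M G P Q β U μ K n := rfl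

/-- V8's two-leg slot is `TwoLegStepV8`. -/
theorem klPredsV8_twoLeg (L M : ℕ) [NeZero L] [NeZero M] (G : GeoConsts) (P : SplitConsts) (Q : EngConsts) (R : RenConsts)
    (β U μ : ℝ) (K : TrigPolyC4v) (n : ℕ) :
    klPredsV8.twoLeg L M G P Q R β U μ K n = TwoLegStepV8 L M G P Q R β U μ K n := rfl

/-- The V8 history at `j` IS the three V8 slots at `j`: `HistP klPredsV8 … n` (at any volume) yields `histV8 … K j` for every `j < n`. -/
theorem histV8_of_histP {L M : ℕ} [NeZero L] [NeZero M] {G : GeoConsts} {P : SplitConsts} {Q : EngConsts} {R : RenConsts}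
    {β U μ : ℝ} {K : TrigPolyC4v} {n : ℕ} (h : HistP klPredsV8 L M G P Q R β U μ K n) :
    ∀ j < n, histV8 L M G P Q R β U μ K j := fun j hj =>
  ⟨(h j hj).1, (h j hj).2.1, (h j hj).2.2.1⟩

/-- The «G» two-leg step is the first conjunct of the V8 two-leg slot. -/
theorem twoLegStepG_of_twoLegStepV8 {L M : ℕ} [NeZero L] [NeZero M] {G : GeoConsts} {P : SplitConsts} {Q : EngConsts} {R : RenConsts}
    {β U μ : ℝ} {K : TrigPolyC4v} {n : ℕ} (h : TwoLegStepV8 L M G P Q R β U μ K n) :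
    TwoLegStepG L M (histV8 L M G P Q R β U μ) G P Q R β U μ K n := h.1

/-- `HistP klPredsV8` below `n` yields the full (E3f) antecedent at that volume: `histV8 ∧ TwoLegStepG histV8` at every `j < n`. -/
theorem histRateV8_of_histP {L M : ℕ} [NeZero L] [NeZero M] {G : GeoConsts} {P : SplitConsts} {Q : EngConsts} {R : RenConsts}
    {β U μ : ℝ} {K : TrigPolyC4v} {n : ℕ} (h : HistP klPredsV8 L M G P Q R β U μ K n) :
    ∀ j < n, histV8 L M G P Q R β U μ K j ∧ TwoLegStepG L M (histV8 L M G P Q R β U μ) G P Q R β U μ K j := fun j hj =>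
  ⟨⟨(h j hj).1, (h j hj).2.1, (h j hj).2.2.1⟩, (h j hj).2.2.2.1⟩

/-! ## §4 At scale `0` the (D) count is not read: V6S and V5S coincide there -/

section ScaleZero

variable (L M : ℕ) [NeZero L] [NeZero M]

/-- At `n = 0` the v6 ladder clause IS the v5 one (only the ultraviolet conjunct is live). -/
theorem pairLadderStepAtV6_zero_iff (G : GeoConsts) (P : SplitConsts) (Q : EngConsts) (β U μ : ℝ) (K : TrigPolyC4v) :
    PairLadderStepAtV6 L M G P Q β U μ K 0 ↔ PairLadderStepAtV5 L M G P Q β U μ K 0 := by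
  simp [PairLadderStepAtV6, PairLadderStepAtV5]

/-- At `n = 0` the v6 pair-value increment clause holds vacuously. -/
theorem pairValueIncrementAtV6_zero (G : GeoConsts) (P : SplitConsts) (Q : EngConsts) (β U μ : ℝ) (K : TrigPolyC4v) :
    PairValueIncrementAtV6 L M G P Q β U μ K 0 := fun h => absurd h (by norm_num)

/-- At `n = 0` the S3 quartic-value increment clause holds vacuously. -/
theorem quarticValueIncrementAtS3_zero (G : GeoConsts) (P : SplitConsts) (Q : EngConsts) (β U μ : ℝ) (K : TrigPolyC4v) :
    QuarticValueIncrementAtS3 L M G P Q β U μ K 0 := fun h => absurd h (by norm_num)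

/-- **At scale `0` the two engine slots agree**: `EngineBoundsAtV6S … 0 ↔ EngineBoundsAtV5S … 0` (the rung `stub_engine_scale0` is
count-independent). -/
theorem engineBoundsAtV6S_zero_iff (G : GeoConsts) (P : SplitConsts) (Q : EngConsts) (β U μ : ℝ) (K : TrigPolyC4v) :
    EngineBoundsAtV6S L M G P Q β U μ K 0 ↔ EngineBoundsAtV5S L M G P Q β U μ K 0 := by
  have h1 := pairLadderStepAtV6_zero_iff L M G P Q β U μ K
  have h2 := pairValueIncrementAtV6_zero L M G P Q β U μ K
  have h3 := quarticValueIncrementAtS3_zero L M G P Q β U μ K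
  have h2' : PairValueIncrementAtV5 L M G P Q β U μ K 0 := fun h => absurd h (by norm_num)
  have h3' : QuarticValueIncrementAtS2 L M G P Q β U μ K 0 := fun h => absurd h (by norm_num)
  unfold EngineBoundsAtV6S EngineBoundsAtV5S
  tauto

end ScaleZero

end Summit.HubbardSuperconductivity.HubbardSuperconductivity.Theorems.KLRegimeSplit

end
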